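import Mathlib
import HarnessLib
import Literature.Analysis.FluidPDE.KNSSMildBootstrapTools
import Summits.HubbardSuperconductivity.HubbardSuperconductivity.Theorems.KLProgrammeC4aFoldLevelSets

/-!
# Route `KLProgramme` — crux C4a, S3 (B4)-(T) — FOLD-WINDOW CALCULUS, part 3 («(B4)-TAN-FOLD», THE FOLD SUBSTITUTION):
# `∫_{α..β} u(g φ) dφ ≤ (2√b)⁻¹·(∫_{g c..g α} + ∫_{g c..g β}) u(y)(y − g c)^{−1/2} dy` — a tangency-window term is a LEVEL integral against `(y − g_min)^{−1/2}`

Cell `gate-hubbard-kl`, seat hubbard-kl-k3c3-p3 (g21; row «implicit-function / monotonicity route»).  Located brick for the (C)-closer lane c4a-1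
(stub (C) `stub_twoLeg_curvature` of `KLRegimeEngineV17F2`, stmt-HubbardSuperconductivity-20437), C4A-PLAN §24.2/§24.4/§24.9: the (T)-counterpart of the
monotone substitution `…C4aLoopIBPBounds.intervalIntegral_comp_le_of_abs_deriv_ge`.  At a fold the slope floor is not uniform but `g′ ≥ 2√b·√(g − g c)`
(`…C4aFoldLevelSets.fold_deriv_ge_right`), so the substitution `y = g φ` on each half-window pays `dφ ≤ dy/(2√b·√(y − g c))`:

* **`fold_substitution_right`** / **`fold_substitution_left`** (one half-window, minimum at the end), **`fold_substitution`** (window `[α, β]`, minimiser `c`):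
  `∫_{α..β} u(g φ) dφ ≤ (2√b)⁻¹ · (∫_{g c..g α} + ∫_{g c..g β}) u(y)·(y − g c)^{−1/2} dy` for continuous `u ≥ 0`; **`fold_substitution_max`**:
  `≤ (√b)⁻¹ · ∫_{g c..max(g α, g β)} u(y)(y − g c)^{−1/2} dy`;
* **`norm_intervalIntegral_smul_comp_le_fold_level`**: `‖∫_{α..β} w φ • Ψ(g φ) dφ‖ ≤ W·(2√b)⁻¹·(∫_{g c..g α} + ∫_{g c..g β}) ‖Ψ y‖(y − g c)^{−1/2} dy` for `|w| ≤ W`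
  on the window and continuous `Ψ : ℝ → E` — a tangency-window term is priced by a level integral of `‖Ψ‖` against the square-root weight: no `Ψ′`, no
  `Λ_n⁻¹` for the window (with `‖Ψ‖ ≤ M` on a shell of width `2ε` above/below the fold this is `≤ W·M·2√(2ε)/√b`, the `2^{−J/2}` of §24.4).

Proof device (the row's): compare the two primitives `t ↦ ∫_{c..t} u(g)` and `t ↦ (2√b)⁻¹∫_{g c..g t} u(y)(y − g c)^{−1/2}dy` by their derivatives on `(c, β)`
(`monotoneOn_of_deriv_nonneg`); the singular weight is handled with `Literature.Analysis.FluidPDE.KNSSBootstrap.intervalIntegrable_rpow_neg_half_sub_left`.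
Carrier-free (`g, u, w : ℝ → ℝ`, `Ψ : ℝ → E`); nothing is asserted about the Hubbard model.
References: FST II, CPAM 51 (1998) §3 [cite: FeldmanSalmhoferTrubowitz1998]; BGM 2006 §2.4 [cite: BenfattoGiulianiMastropietro2006].
-/

noncomputable section

namespace Summit.HubbardSuperconductivity.HubbardSuperconductivity.Theorems.C4a

set_option linter.dupNamespace false -- summit = problem name (single-conjunct summit), D-0017

open Real Set Filter MeasureTheory intervalIntegral
open scoped Topology ENNReal
open Literature.Analysis.FluidPDE.KNSSBootstrap

variable {E : Type*} [NormedAddCommGroup E] [NormedSpace ℝ E]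

/-! ## §4 The fold substitution: a tangency-window integral is a LEVEL integral against `(y − g_min)^{−1/2}` -/

section Substitution

variable {g u : ℝ → ℝ} {b α β c : ℝ}

/-- The level weight `u(y)·(y − m)^{−1/2}` is interval integrable for continuous `u`. -/
theorem intervalIntegrable_mul_rpow_neg_half (hu : Continuous u) (m p q : ℝ) :
    IntervalIntegrable (fun y => u y * (y - m) ^ (-(1 / 2 : ℝ))) volume p q :=
  (intervalIntegrable_rpow_neg_half_sub_left p q m).continuousOn_mul hu.continuousOn

/-- **FOLD SUBSTITUTION, RIGHT HALF**: `c ≤ β`, `g ∈ C²` with `g″ ≥ 2b > 0` on `[c, β]` and its minimum at `c`, `u ≥ 0` continuous ⟹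
`∫_{c..β} u(g φ) dφ ≤ (2√b)⁻¹ · ∫_{g c..g β} u(y)·(y − g c)^{−1/2} dy` (`dφ = dy/g′ ≤ dy/(2√b·√(y − g c))`). [folklore] -/
theorem fold_substitution_right (hcβ : c ≤ β) (hg : ContDiff ℝ 2 g) (hb : 0 < b) (hconv : ∀ t ∈ Icc c β, 2 * b ≤ iteratedDeriv 2 g t)
    (hmin : ∀ t ∈ Icc c β, g c ≤ g t) (hu : Continuous u) (hu0 : ∀ y, 0 ≤ u y) :
    ∫ φ in c..β, u (g φ) ≤ (2 * Real.sqrt b)⁻¹ * ∫ y in g c..g β, u y * (y - g c) ^ (-(1 / 2 : ℝ)) := by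
  set v : ℝ → ℝ := fun y => u y * (y - g c) ^ (-(1 / 2 : ℝ)) with hv
  have hvi : ∀ p q, IntervalIntegrable v volume p q := fun p q => intervalIntegrable_mul_rpow_neg_half hu (g c) p q
  set P₁ : ℝ → ℝ := fun t => ∫ φ in c..t, u (g φ) with hP₁
  set I : ℝ → ℝ := fun z => ∫ y in g c..z, v y with hI
  set D : ℝ → ℝ := fun t => (2 * Real.sqrt b)⁻¹ * I (g t) - P₁ t with hD
  have hug : Continuous (fun φ => u (g φ)) := hu.comp hg.continuous
  have hP₁d : ∀ t, HasDerivAt P₁ (u (g t)) t := fun t =>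
    intervalIntegral.integral_hasDerivAt_right (hug.intervalIntegrable _ _) (hug.stronglyMeasurableAtFilter _ _) hug.continuousAt
  have hIc : Continuous I := intervalIntegral.continuous_primitive hvi (g c)
  have hId : ∀ z, g c < z → HasDerivAt I (v z) z := by
    intro z hz
    have hvc : ContinuousOn v (Ioi (g c)) := fun y hy =>
      (hu.continuousAt.mul ((continuousAt_id.sub continuousAt_const).rpow_const (Or.inl (sub_pos.2 hy).ne'))).continuousWithinAt
    exact intervalIntegral.integral_hasDerivAt_right (hvi _ _) (hvc.stronglyMeasurableAtFilter isOpen_Ioi z hz)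
      (hvc.continuousAt (Ioi_mem_nhds hz))
  have hDc : ContinuousOn D (Icc c β) :=
    ((continuous_const.mul (hIc.comp hg.continuous)).sub (continuous_iff_continuousAt.2 fun t => (hP₁d t).continuousAt)).continuousOn
  have hDd : ∀ t ∈ Ioo c β, HasDerivAt D ((2 * Real.sqrt b)⁻¹ * (v (g t) * deriv g t) - u (g t)) t := by
    intro t ht
    have hgt : g c < g t := fold_strictMonoOn_right hg hb hconv hmin (left_mem_Icc.2 hcβ) ⟨ht.1.le, ht.2.le⟩ ht.1
    have h1 : HasDerivAt (fun t => I (g t)) (v (g t) * deriv g t) t := (hId _ hgt).comp t (hasDerivAt_of_two hg t)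
    exact (h1.const_mul _).sub (hP₁d t)
  have hb' : 0 < 2 * Real.sqrt b := by positivity
  have hmono : MonotoneOn D (Icc c β) := by
    refine monotoneOn_of_deriv_nonneg (convex_Icc c β) hDc (fun t ht => ?_) fun t ht => ?_
    · rw [interior_Icc] at ht; exact (hDd t ht).differentiableAt.differentiableWithinAt
    · rw [interior_Icc] at ht
      rw [(hDd t ht).deriv]
      have hgt : 0 < g t - g c := sub_pos.2 (fold_strictMonoOn_right hg hb hconv hmin (left_mem_Icc.2 hcβ) ⟨ht.1.le, ht.2.le⟩ ht.1)
      have hge := fold_deriv_ge_right hg hb hconv hmin ⟨ht.1, ht.2.le⟩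
      have hr : (g t - g c) ^ (-(1 / 2 : ℝ)) * Real.sqrt (g t - g c) = 1 := by
        rw [Real.sqrt_eq_rpow]; exact rpow_neg_half_mul_rpow_half hgt
      have hkey : 2 * Real.sqrt b * u (g t) ≤ v (g t) * deriv g t := by
        calc 2 * Real.sqrt b * u (g t) = u (g t) * (2 * Real.sqrt b) * ((g t - g c) ^ (-(1 / 2 : ℝ)) * Real.sqrt (g t - g c)) := by
              rw [hr, mul_one]; ring
          _ = u (g t) * (g t - g c) ^ (-(1 / 2 : ℝ)) * (2 * Real.sqrt b * Real.sqrt (g t - g c)) := by ring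
          _ ≤ u (g t) * (g t - g c) ^ (-(1 / 2 : ℝ)) * deriv g t :=
              mul_le_mul_of_nonneg_left hge (mul_nonneg (hu0 _) (Real.rpow_nonneg hgt.le _))
      have h2 := mul_le_mul_of_nonneg_left hkey (inv_nonneg.2 hb'.le)
      rw [← mul_assoc, inv_mul_cancel₀ hb'.ne', one_mul] at h2
      linarith
  have h := hmono (left_mem_Icc.2 hcβ) (right_mem_Icc.2 hcβ) hcβ
  simp only [hD, hI, hP₁, intervalIntegral.integral_same, mul_zero, sub_zero] at h
  linarith

/-- **FOLD SUBSTITUTION, LEFT HALF**: `α ≤ c`, `g″ ≥ 2b > 0` on `[α, c]`, minimum at `c` ⟹ `∫_{α..c} u(g φ) dφ ≤ (2√b)⁻¹ · ∫_{g c..g α} u(y)(y − g c)^{−1/2} dy`. [folklore] -/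
theorem fold_substitution_left (hαc : α ≤ c) (hg : ContDiff ℝ 2 g) (hb : 0 < b) (hconv : ∀ t ∈ Icc α c, 2 * b ≤ iteratedDeriv 2 g t)
    (hmin : ∀ t ∈ Icc α c, g c ≤ g t) (hu : Continuous u) (hu0 : ∀ y, 0 ≤ u y) :
    ∫ φ in α..c, u (g φ) ≤ (2 * Real.sqrt b)⁻¹ * ∫ y in g c..g α, u y * (y - g c) ^ (-(1 / 2 : ℝ)) := by
  obtain ⟨h1, h2, h3⟩ := fold_reflect_hyps hg hconv hmin
  have h := fold_substitution_right (u := u) (by linarith : -c ≤ -α) h1 hb h2 h3 hu hu0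
  simp only [neg_neg] at h
  have e : ∫ φ in -c..-α, u (g (-φ)) = ∫ φ in α..c, u (g φ) := by
    rw [intervalIntegral.integral_comp_neg (fun φ => u (g φ))]; simp
  rwa [e] at h

/-- **THE FOLD SUBSTITUTION**: `g ∈ C²`, `g″ ≥ 2b > 0` on `[α, β]`, minimiser `c ∈ [α, β]`, `u ≥ 0` continuous ⟹
`∫_{α..β} u(g φ) dφ ≤ (2√b)⁻¹ · (∫_{g c..g α} + ∫_{g c..g β}) u(y)(y − g c)^{−1/2} dy`. [folklore] -/
theorem fold_substitution (hg : ContDiff ℝ 2 g) (hb : 0 < b) (hconv : ∀ t ∈ Icc α β, 2 * b ≤ iteratedDeriv 2 g t)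
    (hc : c ∈ Icc α β) (hmin : ∀ t ∈ Icc α β, g c ≤ g t) (hu : Continuous u) (hu0 : ∀ y, 0 ≤ u y) :
    ∫ φ in α..β, u (g φ) ≤ (2 * Real.sqrt b)⁻¹ *
      ((∫ y in g c..g α, u y * (y - g c) ^ (-(1 / 2 : ℝ))) + ∫ y in g c..g β, u y * (y - g c) ^ (-(1 / 2 : ℝ))) := by
  have hug : Continuous (fun φ => u (g φ)) := hu.comp hg.continuous
  have hl := fold_substitution_left hc.1 hg hb (fun s hs => hconv s ⟨hs.1, hs.2.trans hc.2⟩) (fun s hs => hmin s ⟨hs.1, hs.2.trans hc.2⟩) hu hu0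
  have hr := fold_substitution_right hc.2 hg hb (fun s hs => hconv s ⟨hc.1.trans hs.1, hs.2⟩) (fun s hs => hmin s ⟨hc.1.trans hs.1, hs.2⟩) hu hu0
  rw [← intervalIntegral.integral_add_adjacent_intervals (hug.intervalIntegrable α c) (hug.intervalIntegrable c β), mul_add]
  exact add_le_add hl hr

/-- **THE FOLD SUBSTITUTION, ONE LEVEL RANGE**: the same with both branches collected over `[g c, max (g α) (g β)]`:
`∫_{α..β} u(g φ) dφ ≤ (√b)⁻¹ · ∫_{g c..max(g α, g β)} u(y)(y − g c)^{−1/2} dy`. [folklore] -/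
theorem fold_substitution_max (hg : ContDiff ℝ 2 g) (hb : 0 < b) (hconv : ∀ t ∈ Icc α β, 2 * b ≤ iteratedDeriv 2 g t)
    (hc : c ∈ Icc α β) (hmin : ∀ t ∈ Icc α β, g c ≤ g t) (hu : Continuous u) (hu0 : ∀ y, 0 ≤ u y) :
    ∫ φ in α..β, u (g φ) ≤ (Real.sqrt b)⁻¹ * ∫ y in g c..max (g α) (g β), u y * (y - g c) ^ (-(1 / 2 : ℝ)) := by
  have h := fold_substitution hg hb hconv hc hmin hu hu0
  have hvi := intervalIntegrable_mul_rpow_neg_half hu (g c)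
  have hv0 : 0 ≤ᵐ[volume.restrict (Ioc (g c) (max (g α) (g β)))] fun y => u y * (y - g c) ^ (-(1 / 2 : ℝ)) := by
    refine (ae_restrict_mem measurableSet_Ioc).mono fun y hy => ?_
    exact mul_nonneg (hu0 _) (Real.rpow_nonneg (sub_pos.2 hy.1).le _)
  have hα : ∫ y in g c..g α, u y * (y - g c) ^ (-(1 / 2 : ℝ)) ≤ ∫ y in g c..max (g α) (g β), u y * (y - g c) ^ (-(1 / 2 : ℝ)) :=
    intervalIntegral.integral_mono_interval le_rfl (hmin α (left_mem_Icc.2 (hc.1.trans hc.2))) (le_max_left _ _) hv0 (hvi _ _)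
  have hβ : ∫ y in g c..g β, u y * (y - g c) ^ (-(1 / 2 : ℝ)) ≤ ∫ y in g c..max (g α) (g β), u y * (y - g c) ^ (-(1 / 2 : ℝ)) :=
    intervalIntegral.integral_mono_interval le_rfl (hmin β (right_mem_Icc.2 (hc.1.trans hc.2))) (le_max_right _ _) hv0 (hvi _ _)
  have hb' : 0 < Real.sqrt b := Real.sqrt_pos.2 hb
  calc ∫ φ in α..β, u (g φ) ≤ _ := h
    _ ≤ (2 * Real.sqrt b)⁻¹ * (2 * ∫ y in g c..max (g α) (g β), u y * (y - g c) ^ (-(1 / 2 : ℝ))) :=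
        mul_le_mul_of_nonneg_left (by linarith) (by positivity)
    _ = (Real.sqrt b)⁻¹ * ∫ y in g c..max (g α) (g β), u y * (y - g c) ^ (-(1 / 2 : ℝ)) := by
        field_simp

/-- **THE TANGENCY-WINDOW TERM IN LEVEL CURRENCY**: `α ≤ β`, fold hypotheses on `[α, β]`, `|w| ≤ W` on `[α, β]`, `Ψ` continuous ⟹
`‖∫_{α..β} w φ • Ψ(g φ) dφ‖ ≤ W · (2√b)⁻¹ · (∫_{g c..g α} + ∫_{g c..g β}) ‖Ψ y‖ (y − g c)^{−1/2} dy` — the (T)-counterpart of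
`…C4aLoopIBPBounds.norm_intervalIntegral_smul_iteratedDeriv_comp_le_level`. [folklore] -/
theorem norm_intervalIntegral_smul_comp_le_fold_level (hg : ContDiff ℝ 2 g) (hb : 0 < b) (hconv : ∀ t ∈ Icc α β, 2 * b ≤ iteratedDeriv 2 g t)
    (hc : c ∈ Icc α β) (hmin : ∀ t ∈ Icc α β, g c ≤ g t) {w : ℝ → ℝ} {W : ℝ} (hw : ∀ φ ∈ Icc α β, |w φ| ≤ W) (hW : 0 ≤ W)
    {Ψ : ℝ → E} (hΨ : Continuous Ψ) :
    ‖∫ φ in α..β, w φ • Ψ (g φ)‖ ≤ W * ((2 * Real.sqrt b)⁻¹ *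
      ((∫ y in g c..g α, ‖Ψ y‖ * (y - g c) ^ (-(1 / 2 : ℝ))) + ∫ y in g c..g β, ‖Ψ y‖ * (y - g c) ^ (-(1 / 2 : ℝ)))) := by
  have hαβ : α ≤ β := hc.1.trans hc.2
  have hcont : Continuous fun φ => ‖Ψ (g φ)‖ := (hΨ.comp hg.continuous).norm
  have h1 : ‖∫ φ in α..β, w φ • Ψ (g φ)‖ ≤ ∫ φ in α..β, W * ‖Ψ (g φ)‖ := by
    refine (intervalIntegral.norm_integral_le_integral_norm hαβ).trans ?_
    rw [intervalIntegral.integral_of_le hαβ, intervalIntegral.integral_of_le hαβ]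
    refine integral_mono_of_nonneg (Eventually.of_forall fun _ => norm_nonneg _) ((hcont.const_mul W).integrableOn_Ioc) ?_
    refine (ae_restrict_mem measurableSet_Ioc).mono fun φ hφ => ?_
    show ‖w φ • Ψ (g φ)‖ ≤ W * ‖Ψ (g φ)‖
    rw [norm_smul, Real.norm_eq_abs]
    exact mul_le_mul_of_nonneg_right (hw φ ⟨hφ.1.le, hφ.2⟩) (norm_nonneg _)
  rw [intervalIntegral.integral_const_mul] at h1
  exact h1.trans (mul_le_mul_of_nonneg_left (fold_substitution (u := fun y => ‖Ψ y‖) hg hb hconv hc hmin hΨ.norm (fun _ => norm_nonneg _)) hW)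

end Substitution

end Summit.HubbardSuperconductivity.HubbardSuperconductivity.Theorems.C4a

end
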